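import Summits.QuantumFields.BalabanUV.Beta.FP.MixLoopPowerCounting
import Summits.QuantumFields.BalabanUV.Beta.FP.HorizontalRemainderTotal

/-!
# `BalabanUV.Beta.FP.HorizontalBookkeepingPaired` — road «FP» (binder row D1), organisation γ, owner ruling R-FP-27 (b), row **H3-BOOK (pp→rem)**:
# **THE POINTWISE PAIRED LETTER IMPLIES THE REMAINDER LETTER OF THE γ-END** — `(pp) ∀ v, |T μ ν v − Xtr v| ≤ B·e^{−δ‖v‖∞}` ⟹
# `(rem) ∀ S, Σ_{v∈S} ‖v‖∞²·|T μ ν v − Xtr v| ≤ Bρ` with the EXPLICIT `Bρ = B·(1 + 9600·e^{δ/2}·(2/δ)⁶)`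

HONEST DEPENDENCY (page 1, mandatory): continuum YM on T⁴ ⇐ BetaPertH ∧ nine spine estimates (0/9 proved); BetaPertH ⇐ (D1) ∧ (D4) ∧
CAP+tail; G-an2-4 gates asym, D1 and NE2/3/4.  HONEST FRAMING (cell contract, verbatim): «discharging `BetaPertH` makes Bałaban's UV
stability UNCONDITIONAL — a real constructive-QFT result; it is NOT the continuum limit and NOT the Clay problem.»  THIS MODULE DISCHARGES
NOTHING of the wall: it is one screen of [folklore] bookkeeping over the tree's engine `FP.MixLoopPowerCounting.sum_sq_mul_exp_le` (at `n = 1`)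
BY NAME, in the `DyadicShell` currency (`Pt = Fin 4 → ℤ`, `supNorm`).  No `def`, no `def … : Prop`, nothing cited, 0 sorry; 0∕4 binders of row D1;
NOT hbook, NOT D1, NOT BetaPertH, NOT continuum, NOT Clay.

ABSOLUTE RULE (cell charter, verbatim): «No internally-minted statement may enter as a cited fact. Every hypothesis is either kernel-proved
in this package or a verbatim quotation of a PUBLISHED theorem with page reference. The manuscript(s) under audit are NOT citable for their
own disputed steps — they are the thing under adjudication; programme-internal (2001/route/tribunal) claims are never citable.»

WHY (owner ruling R-FP-27, journal 2026-08-21T02:13:43Z).  The γ-END of record `FP/HorizontalRemainderTotal.abs_secondMoment_sub_window_le_of_remainder`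
consumes ONE letter on the remainder `T − Xtr` (one-shot coarse kernel minus the truncated transport of the comparison kernel):
(rem) `∀ S : Finset Pt, Σ_{v∈S} ‖v‖∞²·|T μ ν v − Xtr v| ≤ Bρ`.  The pairing programme (GAMMA-5∕6, RHOA-6c′, RHOA-7, GAMMA-9 (GH-a), GAMMA-7, RHOA-4
far-fine) delivers the remainder PIECE BY PIECE in the pointwise paired shape (pp) `|T μ ν v − Xtr v| ≤ B·e^{−δ‖v‖∞}` (every remainder leg is
exponentially localised on scale `N`; the long-range pieces carry no window moment).  THIS FILE is the one-screen bridge (pp) ⟹ (rem):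
* `sum_sq_mul_abs_le_of_pointwise_exp` — generic: `|D v| ≤ B·e^{−δ‖v‖∞}` for all `v` ⟹ `Σ_{v∈S} ‖v‖∞²·|D v| ≤ B·(1 + 9600·e^{δ/2}·(2/δ)⁶)` for every finite `S`;
* `rem_of_pp` — the instance `D := T μ ν − Xtr` in the END's literal binder shape;
* `rem_of_pp_uniform` — m-indexed families with m-free `B, δ` give an m-free `Bρ` (the shape of `HorizontalRemainderTotal.hbook_of_remainder`'s `hrem`);
* `sum_sq_mul_abs_le_of_pointwise_exp_add` — two paired pieces with different rates add (the programme lands piece by piece).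
* §2 (v1.1, append-only, after the γ-END of record `FP/HorizontalRemainderTotal` p245503 landed): **`end_of_pp`**, **`hbook_of_pp`**, **`hasym_of_pp`** —
  the END ∕ `hbook` ∕ `hasym` DIRECTLY from (a) + (pp) (+ `hgerm`), BY NAME (`abs_secondMoment_sub_window_le_of_remainder` ∕ `hbook_of_remainder` ∕
  `hasym_of_remainder` ∘ `rem_of_pp(_uniform)`), with the explicit `Bρ = B·(1 + 9600·e^{δ/2}·(2/δ)⁶)`.
Unit `b2b-balaban-beta-d1-formalise-leaf-05` (gen 12), 2026-08-21; `LEAVES-FP.md` row H3-BOOK (pp→rem); journal CLAIM 02:16:19Z.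
-/

noncomputable section

namespace Summit.QuantumFields.BalabanUV.Beta.FP.HorizontalBookkeepingPaired

open Finset Real
open scoped BigOperators
open Literature.MathematicalPhysics.QuantumFieldTheory.Balaban1983to89.Beta.DyadicShell (Pt supNorm)
open Summit.QuantumFields.BalabanUV.Beta.FP.MixLoopPowerCounting (sum_sq_mul_exp_le supNorm_cast_nonneg)

/-- [folklore] **(pp) ⟹ (rem), generic**: if `|D v| ≤ B·e^{−δ‖v‖∞}` for every `v ∈ ℤ⁴` (`0 < δ`, `0 ≤ B`) then for every finite `S ⊂ ℤ⁴`
`Σ_{v∈S} ‖v‖∞²·|D v| ≤ B·(1 + 9600·e^{δ/2}·(2/δ)⁶)` — the tree engine `MixLoopPowerCounting.sum_sq_mul_exp_le` at `n = 1`. -/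
theorem sum_sq_mul_abs_le_of_pointwise_exp {D : Pt → ℝ} {B δ : ℝ} (hδ : 0 < δ) (hB : 0 ≤ B)
    (hpp : ∀ v : Pt, |D v| ≤ B * Real.exp (-δ * (supNorm v : ℝ))) (S : Finset Pt) :
    ∑ v ∈ S, (supNorm v : ℝ) ^ 2 * |D v| ≤ B * (1 + 9600 * Real.exp (δ / 2) * (2 / δ) ^ 6) := by
  have hmaj : ∀ v ∈ S, (supNorm v : ℝ) ^ 2 * |D v| ≤ B * ((supNorm v : ℝ) ^ 2 * Real.exp (-(δ / (1 : ℕ)) * (supNorm v : ℝ))) := by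
    intro v _
    rw [Nat.cast_one, div_one, mul_left_comm]
    exact mul_le_mul_of_nonneg_left (hpp v) (sq_nonneg _)
  calc ∑ v ∈ S, (supNorm v : ℝ) ^ 2 * |D v|
      ≤ ∑ v ∈ S, B * ((supNorm v : ℝ) ^ 2 * Real.exp (-(δ / (1 : ℕ)) * (supNorm v : ℝ))) := Finset.sum_le_sum hmaj
    _ = B * ∑ v ∈ S, (supNorm v : ℝ) ^ 2 * Real.exp (-(δ / (1 : ℕ)) * (supNorm v : ℝ)) := by rw [Finset.mul_sum]
    _ ≤ B * ((1 + 9600 * Real.exp (δ / 2) * (2 / δ) ^ 6) * ((1 : ℕ) : ℝ) ^ 6) :=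
        mul_le_mul_of_nonneg_left (sum_sq_mul_exp_le hδ le_rfl S) hB
    _ = B * (1 + 9600 * Real.exp (δ / 2) * (2 / δ) ^ 6) := by rw [Nat.cast_one, one_pow, mul_one]

/-- [folklore] **(pp) ⟹ (rem), the END's binder**: the pointwise paired letter for `T μ ν − Xtr` gives the remainder letter of
`HorizontalRemainderTotal.abs_secondMoment_sub_window_le_of_remainder` with `Bρ = B·(1 + 9600·e^{δ/2}·(2/δ)⁶)`. -/
theorem rem_of_pp {T : Fin 4 → Fin 4 → Pt → ℝ} {Xtr : Pt → ℝ} {μ ν : Fin 4} {B δ : ℝ} (hδ : 0 < δ) (hB : 0 ≤ B)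
    (hpp : ∀ v : Pt, |T μ ν v - Xtr v| ≤ B * Real.exp (-δ * (supNorm v : ℝ))) :
    ∀ S : Finset Pt, ∑ v ∈ S, (supNorm v : ℝ) ^ 2 * |T μ ν v - Xtr v| ≤ B * (1 + 9600 * Real.exp (δ / 2) * (2 / δ) ^ 6) :=
  fun S => sum_sq_mul_abs_le_of_pointwise_exp (D := fun v => T μ ν v - Xtr v) hδ hB hpp S

/-- [folklore] **(pp) ⟹ (rem), m-uniform**: an m-indexed family (one coarse kernel and one truncated transport per blocking `N = L^m`) with an
m-FREE paired letter has an m-free remainder letter — the `hrem` of `HorizontalRemainderTotal.hbook_of_remainder` ∕ `hasym_of_remainder`. -/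
theorem rem_of_pp_uniform {T : ℕ → Fin 4 → Fin 4 → Pt → ℝ} {Xtr : ℕ → Pt → ℝ} {μ ν : Fin 4} {B δ : ℝ} (hδ : 0 < δ) (hB : 0 ≤ B)
    (hpp : ∀ m : ℕ, 1 ≤ m → ∀ v : Pt, |T m μ ν v - Xtr m v| ≤ B * Real.exp (-δ * (supNorm v : ℝ))) :
    ∀ m : ℕ, 1 ≤ m → ∀ S : Finset Pt,
      ∑ v ∈ S, (supNorm v : ℝ) ^ 2 * |T m μ ν v - Xtr m v| ≤ B * (1 + 9600 * Real.exp (δ / 2) * (2 / δ) ^ 6) :=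
  fun m hm S => rem_of_pp (hδ := hδ) hB (hpp m hm) S

/-- [folklore] **TWO PAIRED PIECES ADD** (the programme lands the remainder piece by piece, with different rates): if `D = D₁ + D₂` pointwise with
`|D₁ v| ≤ B₁·e^{−δ₁‖v‖∞}` and `|D₂ v| ≤ B₂·e^{−δ₂‖v‖∞}` then
`Σ_{v∈S} ‖v‖∞²·|D v| ≤ B₁·(1 + 9600·e^{δ₁/2}·(2/δ₁)⁶) + B₂·(1 + 9600·e^{δ₂/2}·(2/δ₂)⁶)`. -/
theorem sum_sq_mul_abs_le_of_pointwise_exp_add {D D₁ D₂ : Pt → ℝ} {B₁ δ₁ B₂ δ₂ : ℝ} (hδ₁ : 0 < δ₁) (hB₁ : 0 ≤ B₁) (hδ₂ : 0 < δ₂)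
    (hB₂ : 0 ≤ B₂) (hD : ∀ v, D v = D₁ v + D₂ v)
    (h₁ : ∀ v : Pt, |D₁ v| ≤ B₁ * Real.exp (-δ₁ * (supNorm v : ℝ))) (h₂ : ∀ v : Pt, |D₂ v| ≤ B₂ * Real.exp (-δ₂ * (supNorm v : ℝ)))
    (S : Finset Pt) :
    ∑ v ∈ S, (supNorm v : ℝ) ^ 2 * |D v|
      ≤ B₁ * (1 + 9600 * Real.exp (δ₁ / 2) * (2 / δ₁) ^ 6) + B₂ * (1 + 9600 * Real.exp (δ₂ / 2) * (2 / δ₂) ^ 6) := by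
  calc ∑ v ∈ S, (supNorm v : ℝ) ^ 2 * |D v|
      ≤ ∑ v ∈ S, ((supNorm v : ℝ) ^ 2 * |D₁ v| + (supNorm v : ℝ) ^ 2 * |D₂ v|) := by
        refine Finset.sum_le_sum fun v _ => ?_
        rw [hD v, ← mul_add]
        exact mul_le_mul_of_nonneg_left (abs_add_le _ _) (sq_nonneg _)
    _ ≤ _ := by
        rw [Finset.sum_add_distrib]
        exact add_le_add (sum_sq_mul_abs_le_of_pointwise_exp hδ₁ hB₁ h₁ S) (sum_sq_mul_abs_le_of_pointwise_exp hδ₂ hB₂ h₂ S)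

/-- [folklore] **SUMMABLE FORM**: under (pp) the weighted remainder `v ↦ ‖v‖∞²·|D v|` is summable on `ℤ⁴` with `Σ' ≤ B·(1 + 9600·e^{δ/2}·(2/δ)⁶)`
(uniformly bounded finite sums of a non-negative family). -/
theorem summable_sq_mul_abs_of_pointwise_exp {D : Pt → ℝ} {B δ : ℝ} (hδ : 0 < δ) (hB : 0 ≤ B)
    (hpp : ∀ v : Pt, |D v| ≤ B * Real.exp (-δ * (supNorm v : ℝ))) :
    Summable (fun v : Pt => (supNorm v : ℝ) ^ 2 * |D v|) ∧
      ∑' v : Pt, (supNorm v : ℝ) ^ 2 * |D v| ≤ B * (1 + 9600 * Real.exp (δ / 2) * (2 / δ) ^ 6) := by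
  have hnn : ∀ v : Pt, 0 ≤ (supNorm v : ℝ) ^ 2 * |D v| := fun v => mul_nonneg (sq_nonneg _) (abs_nonneg _)
  have hs : Summable (fun v : Pt => (supNorm v : ℝ) ^ 2 * |D v|) :=
    summable_of_sum_le hnn (sum_sq_mul_abs_le_of_pointwise_exp hδ hB hpp)
  exact ⟨hs, hs.tsum_le_of_sum_le (sum_sq_mul_abs_le_of_pointwise_exp hδ hB hpp)⟩

end Summit.QuantumFields.BalabanUV.Beta.FP.HorizontalBookkeepingPaired


/-! ## §2 (v1.1, append-only) The γ-END of record from (a) + (pp), BY NAME -/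

namespace Summit.QuantumFields.BalabanUV.Beta.FP.HorizontalBookkeepingPaired

open Literature.MathematicalPhysics.QuantumFieldTheory.Balaban1983to89
open Literature.MathematicalPhysics.QuantumFieldTheory.Balaban1983to89.Beta
open Literature.MathematicalPhysics.QuantumFieldTheory.Balaban1983to89.Beta.DyadicShell (Pt supNorm)
open Summit.QuantumFields.BalabanUV.Beta.FP.HorizontalRemainderTotal (abs_secondMoment_sub_window_le_of_remainder hbook_of_remainder
  hasym_of_remainder)

/-- [folklore] **THE γ-END FROM (a) + (pp)**: the truncated transport's total coarse second moment (a) and the pointwise paired letter (pp)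
`|T μ ν v − Xtr v| ≤ B·e^{−δ‖v‖∞}` give `Summable (v ↦ T μ ν v·v_μ·v_ν)` and `|secondMoment T μ ν − gN| ≤ U₀ + B·(1 + 9600·e^{δ/2}·(2/δ)⁶)` —
`HorizontalRemainderTotal.abs_secondMoment_sub_window_le_of_remainder` ∘ `rem_of_pp`. -/
theorem end_of_pp {T : Fin 4 → Fin 4 → Pt → ℝ} {Xtr : Pt → ℝ} {μ ν : Fin 4} {gN E₀ U₀ B δ : ℝ}
    (ha : HasSum (fun v : Pt => Xtr v * (v μ : ℝ) * (v ν : ℝ)) (gN + E₀)) (hE₀ : |E₀| ≤ U₀) (hδ : 0 < δ) (hB : 0 ≤ B)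
    (hpp : ∀ v : Pt, |T μ ν v - Xtr v| ≤ B * Real.exp (-δ * (supNorm v : ℝ))) :
    Summable (fun v : Pt => T μ ν v * (v μ : ℝ) * (v ν : ℝ)) ∧
      |B12Beta.secondMoment T μ ν - gN| ≤ U₀ + B * (1 + 9600 * Real.exp (δ / 2) * (2 / δ) ^ 6) :=
  abs_secondMoment_sub_window_le_of_remainder ha hE₀ (rem_of_pp hδ hB hpp)

/-- [folklore] **`hbook` FROM (a) + (pp), m-UNIFORMLY**: `|f m − g(L^m)| ≤ U₀ + B·(1 + 9600·e^{δ/2}·(2/δ)⁶)` for every `m ≥ 1`. -/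
theorem hbook_of_pp {T : ℕ → Fin 4 → Fin 4 → Pt → ℝ} {Xtr : ℕ → Pt → ℝ} {g : ℕ → ℝ} {E₀ : ℕ → ℝ} {μ ν : Fin 4} {L : ℕ} {U₀ B δ : ℝ}
    (ha : ∀ m : ℕ, 1 ≤ m → HasSum (fun v : Pt => Xtr m v * (v μ : ℝ) * (v ν : ℝ)) (g (L ^ m) + E₀ m))
    (hE₀ : ∀ m : ℕ, 1 ≤ m → |E₀ m| ≤ U₀) (hδ : 0 < δ) (hB : 0 ≤ B)
    (hpp : ∀ m : ℕ, 1 ≤ m → ∀ v : Pt, |T m μ ν v - Xtr m v| ≤ B * Real.exp (-δ * (supNorm v : ℝ))) :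
    ∀ m : ℕ, 1 ≤ m → |B12Beta.secondMoment (T m) μ ν - g (L ^ m)| ≤ U₀ + B * (1 + 9600 * Real.exp (δ / 2) * (2 / δ) ^ 6) :=
  hbook_of_remainder ha hE₀ (rem_of_pp_uniform hδ hB hpp)

/-- [folklore] **`hasym` FROM (a) + (pp) + the windowed germ letter**, BY NAME `HorizontalRemainderTotal.hasym_of_remainder`. -/
theorem hasym_of_pp {T : ℕ → Fin 4 → Fin 4 → Pt → ℝ} {Xtr : ℕ → Pt → ℝ} {g : ℕ → ℝ} {E₀ : ℕ → ℝ} {μ ν : Fin 4} {L : ℕ}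
    {U₀ B δ s c₀ C : ℝ} (hL : 1 ≤ L)
    (ha : ∀ m : ℕ, 1 ≤ m → HasSum (fun v : Pt => Xtr m v * (v μ : ℝ) * (v ν : ℝ)) (g (L ^ m) + E₀ m))
    (hE₀ : ∀ m : ℕ, 1 ≤ m → |E₀ m| ≤ U₀) (hδ : 0 < δ) (hB : 0 ≤ B)
    (hpp : ∀ m : ℕ, 1 ≤ m → ∀ v : Pt, |T m μ ν v - Xtr m v| ≤ B * Real.exp (-δ * (supNorm v : ℝ)))
    (hgerm : ∀ M : ℕ, 1 ≤ M → |g M - (s * Real.log M + c₀)| ≤ C) :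
    ∀ m : ℕ, 1 ≤ m → |B12Beta.secondMoment (T m) μ ν - (m : ℝ) * (s * Real.log L)|
      ≤ (U₀ + B * (1 + 9600 * Real.exp (δ / 2) * (2 / δ) ^ 6)) + C + |c₀| :=
  hasym_of_remainder hL ha hE₀ (rem_of_pp_uniform hδ hB hpp) hgerm

end Summit.QuantumFields.BalabanUV.Beta.FP.HorizontalBookkeepingPaired

end
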